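import Summits.HubbardSuperconductivity.HubbardSuperconductivity.Theorems.AnisotropyChordTransferFibre3KT2bRow
import Summits.HubbardSuperconductivity.HubbardSuperconductivity.Theorems.AnisotropyChordTransferFibre3GradSNormClosed
import Summits.HubbardSuperconductivity.HubbardSuperconductivity.Theorems.AnisotropyChordTransferFibre3GroundExists
import Summits.HubbardSuperconductivity.HubbardSuperconductivity.Theorems.AnisotropyChordTransferFibre3TwoMagnon
import Summits.HubbardSuperconductivity.HubbardSuperconductivity.Theorems.AnisotropyChordTransferFibre3ShellBulk

/-!
# Route `AnisotropyChord` / H0 rotor rung: PartN41-C §3 — `Ψ` BY CLASSES: the `D₄` reduction and the diagonal / anti-diagonal parts of `PsiSemiClosed`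

Theory-1 g22's PartN41-C §3 `PsiSemiClosed` (port …Fibre3KT2bRow), first three clauses, for the ground profile
(`L ≥ 5`, `0 ≤ Δ < 1`; `s = 1 − f` off the origin is even, swap- and mirror-symmetric, so the lag-0 gradient correlations
`ψ_{e,e'} = Σ_{a regular} D_e s(a) D_{e'} s(a)` are `D₄`-invariant: ★ `psiCorr_equiv`):
* ★ `psiSum_classes`: `Ψ = 4ψ_{x,x}² + 4ψ_{x,−x}² + 8ψ_{x,y}²`;
* ★ `psi_xx_eq`: `ψ_{x,x} = τ̄ − κ_w` (the five contact sites carry `(∇ₓs)² = η², η², ξ², ζ², ζ²`: ★ `sum_reg_eq`, the contact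
  gradient values `Ds_*`);
* ★ `abs_psi_xnx_le`: `|ψ_{x,−x}| ≤ ψ_{x,x}` (`2|pq| ≤ p² + q²` and `ψ_{−x,−x} = ψ_{x,x}`);
* ★ `cross_contact`: the contact part of `Σ_a ∇ₓs∇_y s` is `crossW = η² − 2ηζ + 2ξζ` (used by the cross class, next file).
Prover seat `hubbard-h0-rotor-p1` g27 (route lead); helper for stmt-HubbardSuperconductivity-23918 (`--supports`, helper class).
WHAT THIS IS NOT: nothing here proves superconductivity in the Hubbard model; bookkeeping of one input of ONE row of ONE
conditional reduction.  Tree imports only; no new definitions; no sorry, no axioms.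
-/

set_option linter.dupNamespace false
set_option autoImplicit false

noncomputable section

open scoped BigOperators

namespace Summit.HubbardSuperconductivity.HubbardSuperconductivity.Theorems.AnisotropyChord.Transfer.Fibre3

variable (L : ℕ) [NeZero L]

namespace RowC

/-! ## §1 `D₄` invariance of `ψ` -/

/-- transport of `ψ_{e,e'}` along a lattice symmetry `R` fixing `s` and the regular set. [folklore] -/
theorem psiCorr_equiv (Δ : ℝ) (f : Tor L → ℝ) (R : Tor L ≃ Tor L) (hsub : ∀ a b : Tor L, R (a - b) = R a - R b)
    (hs : ∀ a : Tor L, sfun' L Δ f (R a) = sfun' L Δ f a) (hreg : ∀ a : Tor L, IsReg L (R a) ↔ IsReg L a)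
    (e e' : Tor L) : psiCorr L Δ f (R e) (R e') = psiCorr L Δ f e e' := by
  classical
  unfold psiCorr
  rw [Finset.sum_filter, Finset.sum_filter]
  symm
  refine Fintype.sum_equiv R _ _ (fun a => ?_)
  simp only [hreg]
  split_ifs
  · unfold Dgrad
    rw [← hsub, ← hsub, hs, hs, hs]
  · rfl

omit [NeZero L] in
/-- `IsReg` is inversion invariant. [folklore] -/
theorem isReg_neg (a : Tor L) : IsReg L (-a) ↔ IsReg L a := by
  unfold IsReg; rw [IsNN_neg, neg_ne_zero]

omit [NeZero L] in
/-- `IsReg` is swap invariant. [folklore] -/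
theorem isReg_sw (a : Tor L) : IsReg L (a.2, a.1) ↔ IsReg L a := by
  unfold IsReg; rw [IsNN_swap, Ne, swap_eq_zero_iff]

omit [NeZero L] in
/-- `(−a₁, a₂) = 0 ↔ a = 0`. [folklore] -/
theorem mirror_eq_zero_iff (a : Tor L) : ((-a.1, a.2) : Tor L) = 0 ↔ a = 0 := by
  constructor
  · intro h
    have h1 := congrArg Prod.fst h; have h2 := congrArg Prod.snd h
    simp only [Prod.fst_zero, Prod.snd_zero, neg_eq_zero] at h1 h2
    exact Prod.ext h1 h2
  · intro h; rw [h]; simp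

omit [NeZero L] in
/-- `IsReg` is mirror invariant. [folklore] -/
theorem isReg_mi (a : Tor L) : IsReg L (-a.1, a.2) ↔ IsReg L a := by
  unfold IsReg; rw [isNN_mirror, Ne, mirror_eq_zero_iff]

omit [NeZero L] in
/-- `s(−a) = s(a)` for even `f`. [folklore] -/
theorem sfun'_neg (Δ : ℝ) {f : Tor L → ℝ} (heven : ∀ r : Tor L, f (-r) = f r) (a : Tor L) :
    sfun' L Δ f (-a) = sfun' L Δ f a := by
  unfold sfun'; simp only [neg_eq_zero, heven]

omit [NeZero L] in
/-- `s(a₂,a₁) = s(a)` for swap-symmetric `f`. [folklore] -/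
theorem sfun'_sw (Δ : ℝ) {f : Tor L → ℝ} (hsw : ∀ r : Tor L, f (r.2, r.1) = f r) (a : Tor L) :
    sfun' L Δ f (a.2, a.1) = sfun' L Δ f a := by
  unfold sfun'; simp only [swap_eq_zero_iff, hsw]

omit [NeZero L] in
/-- `s(−a₁,a₂) = s(a)` for mirror-symmetric `f`. [folklore] -/
theorem sfun'_mi (Δ : ℝ) {f : Tor L → ℝ} (hmi : ∀ r : Tor L, f (-r.1, r.2) = f r) (a : Tor L) :
    sfun' L Δ f (-a.1, a.2) = sfun' L Δ f a := by
  unfold sfun'; simp only [mirror_eq_zero_iff, hmi]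

/-- ★ inversion: `ψ_{−e,−e'} = ψ_{e,e'}`. [folklore] -/
theorem psi_neg (Δ : ℝ) {f : Tor L → ℝ} (heven : ∀ r : Tor L, f (-r) = f r) (e e' : Tor L) :
    psiCorr L Δ f (-e) (-e') = psiCorr L Δ f e e' :=
  psiCorr_equiv L Δ f (Equiv.neg (Tor L)) (fun a b => by simp; abel)
    (fun a => sfun'_neg L Δ heven a) (fun a => isReg_neg L a) e e'

/-- ★ swap: `ψ_{σe,σe'} = ψ_{e,e'}`. [folklore] -/
theorem psi_sw (Δ : ℝ) {f : Tor L → ℝ} (hsw : ∀ r : Tor L, f (r.2, r.1) = f r) (e e' : Tor L) :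
    psiCorr L Δ f (e.2, e.1) (e'.2, e'.1) = psiCorr L Δ f e e' :=
  psiCorr_equiv L Δ f (Equiv.prodComm (ZMod L) (ZMod L)) (fun a b => by simp)
    (fun a => sfun'_sw L Δ hsw a) (fun a => isReg_sw L a) e e'

/-- ★ mirror: `ψ_{me,me'} = ψ_{e,e'}`. [folklore] -/
theorem psi_mi (Δ : ℝ) {f : Tor L → ℝ} (hmi : ∀ r : Tor L, f (-r.1, r.2) = f r) (e e' : Tor L) :
    psiCorr L Δ f (-e.1, e.2) (-e'.1, e'.2) = psiCorr L Δ f e e' :=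
  psiCorr_equiv L Δ f
    ⟨fun a => (-a.1, a.2), fun a => (-a.1, a.2), fun a => by simp, fun a => by simp⟩
    (fun a b => Prod.ext (by simp; abel) (by simp)) (fun a => sfun'_mi L Δ hmi a) (fun a => isReg_mi L a) e e'

/-- `ψ` is symmetric in its two directions. [folklore] -/
theorem psi_comm (Δ : ℝ) (f : Tor L → ℝ) (e e' : Tor L) : psiCorr L Δ f e e' = psiCorr L Δ f e' e := by
  unfold psiCorr
  exact Finset.sum_congr rfl fun a _ => mul_comm _ _

/-- ★ `Ψ = 4ψ_{x,x}² + 4ψ_{x,−x}² + 8ψ_{x,y}²` for an even, swap- and mirror-symmetric profile. [folklore] -/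
theorem psiSum_classes (Δ : ℝ) {f : Tor L → ℝ} (heven : ∀ r : Tor L, f (-r) = f r)
    (hsw : ∀ r : Tor L, f (r.2, r.1) = f r) (hmi : ∀ r : Tor L, f (-r.1, r.2) = f r) :
    PsiSum L Δ f = 4 * psiCorr L Δ f (ex L) (ex L) ^ 2 + 4 * psiCorr L Δ f (ex L) (-ex L) ^ 2
      + 8 * psiCorr L Δ f (ex L) (ey L) ^ 2 := by
  -- coordinate bookkeeping
  have s1 : (((ex L).2, (ex L).1) : Tor L) = ey L := rfl
  have s2 : (((-ex L).2, (-ex L).1) : Tor L) = -ey L := by unfold ex ey; ext <;> simp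
  have m1 : ((-(ex L).1, (ex L).2) : Tor L) = -ex L := by unfold ex; ext <;> simp
  have m2 : ((-(ey L).1, (ey L).2) : Tor L) = ey L := by unfold ey; ext <;> simp
  -- diagonal class
  have d1 : psiCorr L Δ f (-ex L) (-ex L) = psiCorr L Δ f (ex L) (ex L) := psi_neg L Δ heven _ _
  have d2 : psiCorr L Δ f (ey L) (ey L) = psiCorr L Δ f (ex L) (ex L) := by
    have h := psi_sw L Δ hsw (ex L) (ex L); rw [s1] at h; exact h
  have d3 : psiCorr L Δ f (-ey L) (-ey L) = psiCorr L Δ f (ex L) (ex L) := by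
    rw [psi_neg L Δ heven, d2]
  -- anti-diagonal class
  have a1 : psiCorr L Δ f (-ex L) (ex L) = psiCorr L Δ f (ex L) (-ex L) := by
    have := psi_neg L Δ heven (ex L) (-ex L); rw [neg_neg] at this; exact this
  have a2 : psiCorr L Δ f (ey L) (-ey L) = psiCorr L Δ f (ex L) (-ex L) := by
    have h := psi_sw L Δ hsw (ex L) (-ex L); rw [s1, s2] at h; exact h
  have a3 : psiCorr L Δ f (-ey L) (ey L) = psiCorr L Δ f (ex L) (-ex L) := by
    have := psi_neg L Δ heven (ey L) (-ey L); rw [neg_neg] at this; rw [this, a2]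
  -- perpendicular class
  have p1 : psiCorr L Δ f (-ex L) (ey L) = psiCorr L Δ f (ex L) (ey L) := by
    have h := psi_mi L Δ hmi (ex L) (ey L); rw [m1, m2] at h; exact h
  have p2 : psiCorr L Δ f (-ex L) (-ey L) = psiCorr L Δ f (ex L) (ey L) := psi_neg L Δ heven _ _
  have p3 : psiCorr L Δ f (ex L) (-ey L) = psiCorr L Δ f (ex L) (ey L) := by
    have := psi_neg L Δ heven (-ex L) (ey L); rw [neg_neg] at this; rw [this, p1]
  have p4 : psiCorr L Δ f (ey L) (ex L) = psiCorr L Δ f (ex L) (ey L) := psi_comm L Δ f _ _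
  have p5 : psiCorr L Δ f (ey L) (-ex L) = psiCorr L Δ f (ex L) (ey L) := by rw [psi_comm, p1]
  have p6 : psiCorr L Δ f (-ey L) (ex L) = psiCorr L Δ f (ex L) (ey L) := by rw [psi_comm, p3]
  have p7 : psiCorr L Δ f (-ey L) (-ex L) = psiCorr L Δ f (ex L) (ey L) := by rw [psi_comm, p2]
  unfold PsiSum
  simp only [nnList_map_sum]
  rw [d1, d2, d3, a1, a2, a3, p1, p2, p3, p4, p5, p6, p7]
  ring

/-! ## §2 The regular / contact split and the contact gradient values -/

open Classical in
/-- the non-regular sites are `{0, ±x̂, ±ŷ}`. [folklore] -/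
theorem filter_not_isReg :
    Finset.univ.filter (fun a : Tor L => ¬ IsReg L a) = {0, ex L, -ex L, ey L, -ey L} := by
  ext a
  simp only [Finset.mem_filter, Finset.mem_univ, true_and, Finset.mem_insert, Finset.mem_singleton, IsReg,
    not_and, Bool.not_eq_false]
  constructor
  · intro h
    by_cases ha : a = 0
    · exact Or.inl ha
    · exact Or.inr (eq_of_isNN L (h ha))
  · rintro (h | h | h | h | h)
    · exact fun hne => (hne h).elim
    · intro; rw [h]; exact isNN_ex L
    · intro; rw [h, IsNN_neg]; exact isNN_ex L
    · intro; rw [h]; exact isNN_ey L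
    · intro; rw [h, IsNN_neg]; exact isNN_ey L

open Classical in
/-- ★ `Σ_{regular} g = Σ_all g − (g(0) + g(x̂) + g(−x̂) + g(ŷ) + g(−ŷ))` (`L ≥ 3`). [folklore] -/
theorem sum_reg_eq (hL : 3 ≤ L) (g : Tor L → ℝ) :
    ∑ a ∈ Finset.univ.filter (fun a : Tor L => IsReg L a), g a
      = (∑ a : Tor L, g a) - (g 0 + g (ex L) + g (-ex L) + g (ey L) + g (-ey L)) := by
  classical
  obtain ⟨n1, n2, n3, n4, n5, n6⟩ := nn_distinct L hL
  have hx0 : ex L ≠ 0 := K1_ne_zero L (by omega)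
  have hnx0 : -ex L ≠ 0 := neg_ne_zero.mpr hx0
  have hy0 : ey L ≠ 0 := by
    intro h; have h1 := congrArg Prod.snd h; unfold ey at h1
    haveI : Fact (1 < L) := ⟨by omega⟩
    exact one_ne_zero h1
  have hny0 : -ey L ≠ 0 := neg_ne_zero.mpr hy0
  rw [← Finset.sum_filter_add_sum_filter_not Finset.univ (fun a : Tor L => IsReg L a) g, filter_not_isReg]
  rw [Finset.sum_insert (by simp [hx0.symm, hnx0.symm, hy0.symm, hny0.symm]),
    Finset.sum_insert (by simp [n1, n2, n3]),
    Finset.sum_insert (by simp [n4, n5]),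
    Finset.sum_insert (by simp [n6]), Finset.sum_singleton]
  ring

omit [NeZero L] in
/-- the lattice facts used for the contact values (`L ≥ 3`). [folklore] -/
theorem contact_sites_ne (hL : 3 ≤ L) :
    ex L ≠ 0 ∧ -ex L ≠ 0 ∧ ey L ≠ 0 ∧ -ey L ≠ 0 ∧ -ex L - ex L ≠ 0 ∧ ey L - ex L ≠ 0 ∧ -ey L - ex L ≠ 0 ∧
      ex L - ey L ≠ 0 ∧ -ex L - ey L ≠ 0 ∧ -ey L - ey L ≠ 0 := by
  obtain ⟨n1, n2, n3, n4, n5, n6⟩ := nn_distinct L hL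
  have hx0 : ex L ≠ 0 := K1_ne_zero L (by omega)
  have hy0 : ey L ≠ 0 := by
    intro h; have h1 := congrArg Prod.snd h; unfold ey at h1
    haveI : Fact (1 < L) := ⟨by omega⟩
    exact one_ne_zero h1
  have two_ne : (2 : ZMod L) ≠ 0 := by
    intro h
    have h' : ((2 : ℕ) : ZMod L) = 0 := by exact_mod_cast h
    rw [ZMod.natCast_eq_zero_iff] at h'
    have := Nat.le_of_dvd (by norm_num) h'
    omega
  refine ⟨hx0, neg_ne_zero.mpr hx0, hy0, neg_ne_zero.mpr hy0, ?_, sub_ne_zero.mpr n2.symm, sub_ne_zero.mpr n3.symm,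
    sub_ne_zero.mpr n2, sub_ne_zero.mpr n4, ?_⟩
  · intro h; have := congrArg Prod.fst h; unfold ex at this; simp at this; exact two_ne (by linear_combination -this)
  · intro h; have := congrArg Prod.snd h; unfold ey at this; simp at this; exact two_ne (by linear_combination -this)

/-- ★ the ten contact gradient values of `s` (`L ≥ 3`, two-magnon `f` even, swap- and mirror-symmetric):
`∇ₓs` at `0, x̂, −x̂, ŷ, −ŷ` is `η, −η, ξ, ζ, ζ` and `∇_y s` there is `η, ζ, ζ, −η, ξ`. [folklore] -/
theorem Ds_contact (hL : 3 ≤ L) {Δ lam2 : ℝ} {f : Tor L → ℝ} (hf : IsTwoMagnon L Δ lam2 f)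
    (heven : ∀ r : Tor L, f (-r) = f r) (hsw : ∀ r : Tor L, f (r.2, r.1) = f r)
    (hmi : ∀ r : Tor L, f (-r.1, r.2) = f r) :
    Dgrad L (sfun' L Δ f) (ex L) 0 = etaEff L lam2 ∧
    Dgrad L (sfun' L Δ f) (ex L) (ex L) = -etaEff L lam2 ∧
    Dgrad L (sfun' L Δ f) (ex L) (-ex L) = xiW L f ∧
    Dgrad L (sfun' L Δ f) (ex L) (ey L) = zetaW L f ∧
    Dgrad L (sfun' L Δ f) (ex L) (-ey L) = zetaW L f ∧
    Dgrad L (sfun' L Δ f) (ey L) 0 = etaEff L lam2 ∧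
    Dgrad L (sfun' L Δ f) (ey L) (ex L) = zetaW L f ∧
    Dgrad L (sfun' L Δ f) (ey L) (-ex L) = zetaW L f ∧
    Dgrad L (sfun' L Δ f) (ey L) (ey L) = -etaEff L lam2 ∧
    Dgrad L (sfun' L Δ f) (ey L) (-ey L) = xiW L f := by
  obtain ⟨hx0, hnx0, hy0, hny0, c1, c2, c3, c4, c5, c6⟩ := contact_sites_ne L hL
  have hη := etaEff_eq L hL hf
  have hK : K1 L = ex L := rfl
  -- values of `f` at the sites involved
  have fx : f (-ex L) = f (ex L) := by rw [heven]
  have fy : f (ey L) = f (ex L) := hf.2.1 _ (by unfold nnList ey; simp)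
  have fny : f (-ey L) = f (ex L) := by rw [heven, fy]
  have f2x : f (-ex L - ex L) = f (ex L + ex L) := by rw [← heven]; congr 1; abel
  have fyx : f (ey L - ex L) = f (ex L + ey L) := by
    rw [← hmi (ex L + ey L)]; congr 1; unfold ex ey; ext <;> simp
  have fnyx : f (-ey L - ex L) = f (ex L + ey L) := by rw [← heven]; congr 1; abel
  have fxy : f (ex L - ey L) = f (ex L + ey L) := ShellRow.f_ex_sub_ey L heven hmi
  have fnxy : f (-ex L - ey L) = f (ex L + ey L) := by rw [← heven]; congr 1; abel
  have f2y : f (-ey L - ey L) = f (ex L + ex L) := by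
    rw [← heven, ← hsw (ex L + ex L)]; congr 1; unfold ex ey; ext <;> simp
  rw [hK] at hη
  unfold Dgrad sfun' xiW zetaW
  rw [hK]
  simp only [if_true, if_neg hx0, if_neg hnx0, if_neg hy0, if_neg hny0, zero_sub, sub_self,
    if_neg c1, if_neg c2, if_neg c3, if_neg c4, if_neg c5, if_neg c6, fx, fy, fny, f2x, fyx, fnyx, fxy, fnxy, f2y, hη]
  refine ⟨by ring, by ring, by ring, by ring, by ring, by ring, by ring, by ring, by ring, by ring⟩

/-! ## §3 The diagonal and anti-diagonal clauses -/

/-- ★ `ψ_{x,x} = τ̄ − κ_w` (`L ≥ 3`). [folklore] -/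
theorem psi_xx_eq (hL : 3 ≤ L) {Δ lam2 : ℝ} {f : Tor L → ℝ} (hf : IsTwoMagnon L Δ lam2 f)
    (heven : ∀ r : Tor L, f (-r) = f r) (hsw : ∀ r : Tor L, f (r.2, r.1) = f r)
    (hmi : ∀ r : Tor L, f (-r.1, r.2) = f r) :
    psiCorr L Δ f (ex L) (ex L) = gradNormSq L Δ f - kapW L lam2 f := by
  obtain ⟨d0, dx, dnx, dy, dny, -⟩ := Ds_contact L hL hf heven hsw hmi
  unfold psiCorr
  rw [sum_reg_eq L hL, d0, dx, dnx, dy, dny]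
  have hτ : (∑ a : Tor L, Dgrad L (sfun' L Δ f) (ex L) a * Dgrad L (sfun' L Δ f) (ex L) a) = gradNormSq L Δ f := by
    have hK : K1 L = ex L := rfl
    have hs : sfun' L Δ f = sfun L Δ f := rfl
    unfold gradNormSq gradx Dgrad
    rw [hK, hs]
    exact Finset.sum_congr rfl fun a _ => by ring
  rw [hτ]
  unfold kapW
  ring

/-- ★ `|ψ_{x,−x}| ≤ ψ_{x,x}`. [folklore] -/
theorem abs_psi_xnx_le (Δ : ℝ) {f : Tor L → ℝ} (heven : ∀ r : Tor L, f (-r) = f r) :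
    |psiCorr L Δ f (ex L) (-ex L)| ≤ psiCorr L Δ f (ex L) (ex L) := by
  classical
  have hd : psiCorr L Δ f (-ex L) (-ex L) = psiCorr L Δ f (ex L) (ex L) := psi_neg L Δ heven _ _
  set S := Finset.univ.filter (fun a : Tor L => IsReg L a) with hS
  set p : Tor L → ℝ := fun a => Dgrad L (sfun' L Δ f) (ex L) a with hp
  set q : Tor L → ℝ := fun a => Dgrad L (sfun' L Δ f) (-ex L) a with hq
  have e1 : psiCorr L Δ f (ex L) (ex L) = ∑ a ∈ S, p a * p a := rfl
  have e2 : psiCorr L Δ f (-ex L) (-ex L) = ∑ a ∈ S, q a * q a := rfl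
  have e3 : psiCorr L Δ f (ex L) (-ex L) = ∑ a ∈ S, p a * q a := rfl
  have hplus : 0 ≤ ∑ a ∈ S, (p a + q a) ^ 2 := Finset.sum_nonneg fun a _ => sq_nonneg _
  have hminus : 0 ≤ ∑ a ∈ S, (p a - q a) ^ 2 := Finset.sum_nonneg fun a _ => sq_nonneg _
  have x1 : ∑ a ∈ S, (p a + q a) ^ 2 = (∑ a ∈ S, p a * p a) + 2 * (∑ a ∈ S, p a * q a) + ∑ a ∈ S, q a * q a := by
    rw [Finset.mul_sum, ← Finset.sum_add_distrib, ← Finset.sum_add_distrib]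
    exact Finset.sum_congr rfl fun a _ => by ring
  have x2 : ∑ a ∈ S, (p a - q a) ^ 2 = (∑ a ∈ S, p a * p a) - 2 * (∑ a ∈ S, p a * q a) + ∑ a ∈ S, q a * q a := by
    rw [Finset.mul_sum, ← Finset.sum_sub_distrib, ← Finset.sum_add_distrib]
    exact Finset.sum_congr rfl fun a _ => by ring
  rw [← e1, ← e2, ← e3, hd] at x1 x2
  rw [abs_le]
  constructor <;> linarith

/-- ★ the contact part of the cross correlation: `Σ_{a ∈ {0,±x̂,±ŷ}} ∇ₓs∇_y s = crossW = η² − 2ηζ + 2ξζ` (`L ≥ 3`). [folklore] -/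
theorem cross_contact (hL : 3 ≤ L) {Δ lam2 : ℝ} {f : Tor L → ℝ} (hf : IsTwoMagnon L Δ lam2 f)
    (heven : ∀ r : Tor L, f (-r) = f r) (hsw : ∀ r : Tor L, f (r.2, r.1) = f r)
    (hmi : ∀ r : Tor L, f (-r.1, r.2) = f r) :
    psiCorr L Δ f (ex L) (ey L)
      = (∑ a : Tor L, Dgrad L (sfun' L Δ f) (ex L) a * Dgrad L (sfun' L Δ f) (ey L) a) - crossW L lam2 f := by
  obtain ⟨d0, dx, dnx, dy, dny, e0, ex', enx, ey', eny⟩ := Ds_contact L hL hf heven hsw hmi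
  unfold psiCorr
  rw [sum_reg_eq L hL, d0, dx, dnx, dy, dny, e0, ex', enx, ey', eny]
  unfold crossW
  ring

end RowC

end Summit.HubbardSuperconductivity.HubbardSuperconductivity.Theorems.AnisotropyChord.Transfer.Fibre3

end
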